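import Literature.AlgebraicGeometry.AbelianSchemes.AbelianSchemeQuotientPolarizationExistsAmple
import Literature.AlgebraicGeometry.ModuliOfAbelianVarieties.SiegelTripleDualLevelStructure
import Literature.AlgebraicGeometry.AbelianSchemes.PolarizedAbelianSchemeWithLevelBaseChange
import Literature.AlgebraicGeometry.Motives.RestrictScalarsPoints
import HarnessLib

/-!
# The descended polarisation `λ_B` of the quotient of the universal piece exists: the `polB`/`hpolB` conjuncts of `hExt`

Topic `AlgebraicGeometry/ModuliOfAbelianVarieties`; namespace `Literature.AlgebraicGeometry.ModuliOfAbelianVarieties`; a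
*proofs* file (ONE theorem, an adapter). Cell `hodgecm-mathlib`, socket-(B) chain, `hExt` package of the composer
(★ `Theorems/EquidimHeckeQuotientTriplesOfPiece`, binders :71–:111): at the `S″`-piece
`P′ := 𝓜.univ.baseChange ι′ℚ` of the universal triple over a fine Siegel moduli scheme `𝓜` (any locally noetherian `S″` with
`ℚ`-form `ι′ℚ : S″ → 𝓜`), the quotient `B := A′/K` carries a polarisation `λ_B : B → B̂ = Â′/K′` with
`λ_B = polarizationDesc λ′` — ★ `AbelianSchemeOver.exists_polarization_lam_eq_polarizationDesc_of_charZero_of_odd` (B-p05 (g16):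
`d` odd, characteristic `0`, `λ̄′` onto on geometric points) with its one non-structural input `hsurj` DISCHARGED by
★ `SiegelFineModuliScheme.exists_comp_lam_eq_of_classify` (every triple classified by `𝓜` has `λ̄′_t` onto: pull-back of the
universal dual, `dim Â′_t = g`, [MumfordAV1970] §8 Thm. 1) and `char 0` by `S″.hom : S″ → Spec ℂ`. All (ii)-chain data
(`K, hK, hcov, hG, hsm, hgc, hfree, K′, hcov′, hG′, hsm′, hgc′, hfree′, Φ, h4, hlam`) and `hodd : Odd d` stay binders in the
composer's spelling; consumer B-p04 (g18) by name.

## References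

* D. Mumford, *Abelian Varieties* (2nd ed. 1974), §8 Thm. 1 (p. 77), §23 Thm. 2 (p. 231). [MumfordAV1970]
* D. Mumford, J. Fogarty, F. Kirwan, *GIT*, 3rd ed. (1994), Ch. 6 §2 Prop. 6.10 (p. 121), Ch. 7 §3 Thm. 7.9 (p. 139).
  [MumfordFogartyKirwan1994]
-/

noncomputable section

open CategoryTheory CategoryTheory.Limits AlgebraicGeometry MonoidalCategory CartesianMonoidalCategory
open scoped MonObj
open Literature.AlgebraicGeometry.Motives (SchemeOver)
open Literature.AlgebraicGeometry.AbelianSchemes Literature.AlgebraicGeometry.AbelianSchemes.AbelianSchemeOver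
open Literature.AlgebraicGeometry.RelativeSpec Literature.AlgebraicGeometry.Modules

namespace Literature.AlgebraicGeometry.ModuliOfAbelianVarieties

/-- **`polB` + `hpolB` of the `hExt` package at the universal piece**: for `P′ := 𝓜.univ.baseChange ι′ℚ` over a reduced,
separated, locally noetherian `S″` (char `0` through `S″.hom : S″ → Spec ℂ`), the (ii)-chain quotient data and `d` odd, there is
a polarisation `λ_B` of the quotient dual pair with `λ_B = polarizationDesc λ′`
(★ `exists_polarization_lam_eq_polarizationDesc_of_charZero_of_odd`, `hsurj` := ★ `exists_comp_lam_eq_of_classify`).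
[cite: MumfordAV1970, §23 Thm. 2 (p. 231) (and §8 Thm. 1 (p. 77))] [cite: MumfordFogartyKirwan1994, Ch. 6 §2 Proposition 6.10 (p. 121)] -/
theorem exists_polarization_quotient_univ_piece {g N : ℕ} {δ : Fin g → ℕ} (𝓜 : SiegelFineModuliScheme g N δ)
    [LocallyOfFiniteType 𝓜.M.hom] {S'' : SchemeOver ℂ} (ι'ℚ : S''.restrictScalars ℚ ⟶ 𝓜.M)
    [IsReduced S''.left] [IsLocallyNoetherian S''.left] [S''.left.IsSeparated]
    [IsSeparated ((PolarizedAbelianSchemeWithLevel.baseChange (S' := S''.left) 𝓜.univ ι'ℚ.left).A.X.hom ≫ S''.hom)] [LocallyOfFiniteType ((PolarizedAbelianSchemeWithLevel.baseChange (S' := S''.left) 𝓜.univ ι'ℚ.left).A.X.hom ≫ S''.hom)]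
    [IsSeparated ((PolarizedAbelianSchemeWithLevel.baseChange (S' := S''.left) 𝓜.univ ι'ℚ.left).D.hat.X.hom ≫ S''.hom)] [LocallyOfFiniteType ((PolarizedAbelianSchemeWithLevel.baseChange (S' := S''.left) 𝓜.univ ι'ℚ.left).D.hat.X.hom ≫ S''.hom)]
    [IsCommMonObj (PolarizedAbelianSchemeWithLevel.baseChange (S' := S''.left) 𝓜.univ ι'ℚ.left).A.X]
    (K : Subgroup (PolarizedAbelianSchemeWithLevel.baseChange (S' := S''.left) 𝓜.univ ι'ℚ.left).A.Sections) [Finite K] {d : ℕ}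
    (hK : ∀ σ : K, (σ : (PolarizedAbelianSchemeWithLevel.baseChange (S' := S''.left) 𝓜.univ ι'ℚ.left).A.Sections) ^ d = 1)
    (hcov : ∀ x : (PolarizedAbelianSchemeWithLevel.baseChange (S' := S''.left) 𝓜.univ ι'ℚ.left).A.left, ∃ O : ((PolarizedAbelianSchemeWithLevel.baseChange (S' := S''.left) 𝓜.univ ι'ℚ.left).A.translationActionOver S''.hom K).StableAffineOpens, x ∈ O.1)
    (hG : ∃ _ : GrpObj ((PolarizedAbelianSchemeWithLevel.baseChange (S' := S''.left) 𝓜.univ ι'ℚ.left).A.quotientOver S''.hom K), IsMonHom ((PolarizedAbelianSchemeWithLevel.baseChange (S' := S''.left) 𝓜.univ ι'ℚ.left).A.quotientMk S''.hom K hcov))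
    (hsm : Smooth ((PolarizedAbelianSchemeWithLevel.baseChange (S' := S''.left) 𝓜.univ ι'ℚ.left).A.quotientOver S''.hom K).hom)
    (hgc : GeometricallyConnected ((PolarizedAbelianSchemeWithLevel.baseChange (S' := S''.left) 𝓜.univ ι'ℚ.left).A.quotientOver S''.hom K).hom)
    (hfree : ∀ (Ω : Type) [Field Ω] [IsAlgClosed Ω] (x : Spec (.of Ω) ⟶ (PolarizedAbelianSchemeWithLevel.baseChange (S' := S''.left) 𝓜.univ ι'ℚ.left).A.left) (σ : K), σ ≠ 1 →
      x ≫ ((PolarizedAbelianSchemeWithLevel.baseChange (S' := S''.left) 𝓜.univ ι'ℚ.left).A.translation (σ : (PolarizedAbelianSchemeWithLevel.baseChange (S' := S''.left) 𝓜.univ ι'ℚ.left).A.Sections)).left ≠ x)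
    (K' : Subgroup (PolarizedAbelianSchemeWithLevel.baseChange (S' := S''.left) 𝓜.univ ι'ℚ.left).D.hat.Sections) [Finite K']
    (hcov' : ∀ x : (PolarizedAbelianSchemeWithLevel.baseChange (S' := S''.left) 𝓜.univ ι'ℚ.left).D.hat.left, ∃ O : ((PolarizedAbelianSchemeWithLevel.baseChange (S' := S''.left) 𝓜.univ ι'ℚ.left).D.hat.translationActionOver S''.hom K').StableAffineOpens, x ∈ O.1)
    (hG' : ∃ _ : GrpObj ((PolarizedAbelianSchemeWithLevel.baseChange (S' := S''.left) 𝓜.univ ι'ℚ.left).D.hat.quotientOver S''.hom K'), IsMonHom ((PolarizedAbelianSchemeWithLevel.baseChange (S' := S''.left) 𝓜.univ ι'ℚ.left).D.hat.quotientMk S''.hom K' hcov'))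
    (hsm' : Smooth ((PolarizedAbelianSchemeWithLevel.baseChange (S' := S''.left) 𝓜.univ ι'ℚ.left).D.hat.quotientOver S''.hom K').hom)
    (hgc' : GeometricallyConnected ((PolarizedAbelianSchemeWithLevel.baseChange (S' := S''.left) 𝓜.univ ι'ℚ.left).D.hat.quotientOver S''.hom K').hom)
    (hfree' : ∀ (Ω : Type) [Field Ω] [IsAlgClosed Ω] (x : Spec (.of Ω) ⟶ (PolarizedAbelianSchemeWithLevel.baseChange (S' := S''.left) 𝓜.univ ι'ℚ.left).D.hat.left) (σ : K'), σ ≠ 1 →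
      x ≫ ((PolarizedAbelianSchemeWithLevel.baseChange (S' := S''.left) 𝓜.univ ι'ℚ.left).D.hat.translation (σ : (PolarizedAbelianSchemeWithLevel.baseChange (S' := S''.left) 𝓜.univ ι'ℚ.left).D.hat.Sections)).left ≠ x)
    (Φ : (prodTranslationActionOver ((PolarizedAbelianSchemeWithLevel.baseChange (S' := S''.left) 𝓜.univ ι'ℚ.left).A.quotientBy S''.hom K hcov hG hsm hgc) (PolarizedAbelianSchemeWithLevel.baseChange (S' := S''.left) 𝓜.univ ι'ℚ.left).D.hat S''.hom K' hcov').EquivariantStructure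
      ((PolarizedAbelianSchemeWithLevel.baseChange (S' := S''.left) 𝓜.univ ι'ℚ.left).A.poincarePullback S''.hom K hK hcov hG hsm hgc (PolarizedAbelianSchemeWithLevel.baseChange (S' := S''.left) 𝓜.univ ι'ℚ.left).D hfree))
    (h4 : ∀ {T : Scheme} (f : T ⟶ S''.left) (ℒ : ((PolarizedAbelianSchemeWithLevel.baseChange (S' := S''.left) 𝓜.univ ι'ℚ.left).A.quotientBy S''.hom K hcov hG hsm hgc).RigidifiedLineBundle f),
      ℒ.FibrewisePicZero →
      ∃! g : {g : T ⟶ ((PolarizedAbelianSchemeWithLevel.baseChange (S' := S''.left) 𝓜.univ ι'ℚ.left).D.hat.quotientBy S''.hom K' hcov' hG' hsm' hgc').X.left //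
          g ≫ ((PolarizedAbelianSchemeWithLevel.baseChange (S' := S''.left) 𝓜.univ ι'ℚ.left).D.hat.quotientBy S''.hom K' hcov' hG' hsm' hgc').X.hom = f},
        Nonempty ((Scheme.Modules.pullback (((PolarizedAbelianSchemeWithLevel.baseChange (S' := S''.left) 𝓜.univ ι'ℚ.left).A.quotientBy S''.hom K hcov hG hsm hgc).baseChangeToProd
          ((PolarizedAbelianSchemeWithLevel.baseChange (S' := S''.left) 𝓜.univ ι'ℚ.left).D.hat.quotientBy S''.hom K' hcov' hG' hsm' hgc') f g.1 g.2)).obj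
            ((PolarizedAbelianSchemeWithLevel.baseChange (S' := S''.left) 𝓜.univ ι'ℚ.left).A.poincareQuotRigid S''.hom K hK hcov hG hsm hgc (PolarizedAbelianSchemeWithLevel.baseChange (S' := S''.left) 𝓜.univ ι'ℚ.left).D hfree K' hcov' hG' hsm' hgc' Φ) ≅ ℒ.L))
    (hlam : ∀ σ : K, (PolarizedAbelianSchemeWithLevel.baseChange (S' := S''.left) 𝓜.univ ι'ℚ.left).A.translation (σ : (PolarizedAbelianSchemeWithLevel.baseChange (S' := S''.left) 𝓜.univ ι'ℚ.left).A.Sections) ≫ (PolarizedAbelianSchemeWithLevel.baseChange (S' := S''.left) 𝓜.univ ι'ℚ.left).pol.lam ≫ (PolarizedAbelianSchemeWithLevel.baseChange (S' := S''.left) 𝓜.univ ι'ℚ.left).D.hat.quotientMk S''.hom K' hcov' =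
      (PolarizedAbelianSchemeWithLevel.baseChange (S' := S''.left) 𝓜.univ ι'ℚ.left).pol.lam ≫ (PolarizedAbelianSchemeWithLevel.baseChange (S' := S''.left) 𝓜.univ ι'ℚ.left).D.hat.quotientMk S''.hom K' hcov')
    (hodd : Odd d) :
    ∃ polB : ((PolarizedAbelianSchemeWithLevel.baseChange (S' := S''.left) 𝓜.univ ι'ℚ.left).A.quotientBy S''.hom K hcov hG hsm hgc).Polarization
        ((PolarizedAbelianSchemeWithLevel.baseChange (S' := S''.left) 𝓜.univ ι'ℚ.left).A.dualPairOfQuotientRigidified S''.hom K hK hcov hG hsm hgc (PolarizedAbelianSchemeWithLevel.baseChange (S' := S''.left) 𝓜.univ ι'ℚ.left).D hfree K' hcov' hG' hsm' hgc' hfree' Φ h4),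
      polB.lam = (PolarizedAbelianSchemeWithLevel.baseChange (S' := S''.left) 𝓜.univ ι'ℚ.left).A.polarizationDesc S''.hom K hcov (PolarizedAbelianSchemeWithLevel.baseChange (S' := S''.left) 𝓜.univ ι'ℚ.left).D.hat K' hcov' (PolarizedAbelianSchemeWithLevel.baseChange (S' := S''.left) 𝓜.univ ι'ℚ.left).pol.lam hlam := by
  haveI : IsLocallyNoetherian (S''.restrictScalars ℚ).left := ‹IsLocallyNoetherian S''.left›
  exact (PolarizedAbelianSchemeWithLevel.baseChange (S' := S''.left) 𝓜.univ ι'ℚ.left).A.exists_polarization_lam_eq_polarizationDesc_of_charZero_of_odd S''.hom K hK hcov hG hsm hgc (PolarizedAbelianSchemeWithLevel.baseChange (S' := S''.left) 𝓜.univ ι'ℚ.left).D hfree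
    K' hcov' hG' hsm' hgc' hfree' Φ h4 (PolarizedAbelianSchemeWithLevel.baseChange (S' := S''.left) 𝓜.univ ι'ℚ.left).pol hlam S''.hom hodd
    (fun Ω _ _ s y => SiegelFineModuliScheme.exists_comp_lam_eq_of_classify 𝓜 (T := S''.restrictScalars ℚ) (PolarizedAbelianSchemeWithLevel.baseChange (S' := S''.left) 𝓜.univ ι'ℚ.left) s y)

end Literature.AlgebraicGeometry.ModuliOfAbelianVarieties

end
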